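import Mathlib
import HarnessLib

/-!
# Route LiouvilleSarnak — crux `LiouvilleCutRank` (stmt-ValiantsHypothesis-14775): exact SYMMETRIES of the finely
# interleaved prototype `(CR)^n` (Class A of the leafhand-2 census)

For the bit-interleaving cut (column bit `i` at position `2i`, row bit `i` at position `2i+1`) the cut matrix is
`M_n(r, c) = λ(1 + 2 P(r) + P(c))`, `P(v) = Σ_i [v i] 4^i` (`…InterleavedKernel.cutNumber_interleaved`).  Complete
multiplicativity of `λ` at `2`, `3`, `4` acts on the digit pair `(r, c)` WITHOUT carries in the following cases, giving
exact identities between entries of `M_n`, `M_{n+1}`, `M_{n+2}` (all with `P` written out as the explicit sum):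

* `interleaved_nested` — `M_{n+1}(r0, c0) = M_n(r, c)` (top digits `0`);
* `interleaved_times_four` — `M_{n+1}(1r, 1c) = M_n(r, c)` (`4(1+2P(r)+P(c)) = 1 + 2(1+4P(r)) + (1+4P(c))`, `λ(4)=1`);
* ★ `interleaved_times_two_swap` — `M_{n+1}(c0, 1r) = -M_n(r, c)`: multiplication by `2` SWAPS the roles of rows and
  columns (`2(1+2P(r)+P(c)) = 1 + 2P(c) + (1 + 4P(r))`, `λ(2) = -1`);
* `interleaved_times_three` — `M_{n+2}((1r)0, 00r) = -λ(1 + 8P(r)) = -M_{n+1}(0r, 0)` (`3(1 + 8P(r)) =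
  1 + 2(1 + 4P(r)) + 16P(r)`, digits `2r_i + r_{i-1} ≤ 3`, no carries; `λ(3) = -1`).

Use (census, evidence on the item): if the prototype had bounded rank, `λ(1+2R+C) = Φ(x(R), y(C))` for finite colourings
`x, y` of the base-`4` `{0,1}`-digit set; `interleaved_times_two_swap` forces `y` to factor through `x`, so bounded rank
is equivalent to ONE finite colouring `x` with `λ(1 + 2R + C) = Ψ(x(R), x(C))` — the form any attack on SPARSE KERNEL
DISTINCTNESS must refute, and `interleaved_times_three` is the first carry-free odd constraint on it.

Honest framing: exact bookkeeping identities, no case of the crux; `LiouvilleCutRank`, `DigitalBilinearLiouville`,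
`AlgebraicSarnak` stay OPEN; nothing bears on `VP ≠ VNP`.  No definitions; imports `Mathlib` only.
-/

set_option linter.dupNamespace false

namespace Summit.ValiantsHypothesis.ValiantsHypothesis.Theorems.LiouvilleSarnakLiouvilleCutRank.InterleavedSymmetries

open ArithmeticFunction Finset

/-! ### §1 Digit bookkeeping for `P(v) = Σ_i [v i] 4^i` -/

/-- Appending a top digit `0`: `P(snoc v 0) = P(v)`. [folklore] -/
theorem sum_snoc_false {n : ℕ} (v : Fin n → Bool) :
    (∑ i : Fin (n + 1), ((Fin.snoc v false : Fin (n + 1) → Bool) i).toNat * 4 ^ (i : ℕ)) =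
      ∑ i : Fin n, (v i).toNat * 4 ^ (i : ℕ) := by
  rw [Fin.sum_univ_castSucc]
  simp [Fin.snoc_castSucc, Fin.snoc_last]

/-- Prepending a bottom digit `b`: `P(cons b v) = [b] + 4 P(v)`. [folklore] -/
theorem sum_cons {n : ℕ} (b : Bool) (v : Fin n → Bool) :
    (∑ i : Fin (n + 1), ((Fin.cons b v : Fin (n + 1) → Bool) i).toNat * 4 ^ (i : ℕ)) =
      b.toNat + 4 * ∑ i : Fin n, (v i).toNat * 4 ^ (i : ℕ) := by
  rw [Fin.sum_univ_succ]
  simp only [Fin.cons_zero, Fin.val_zero, pow_zero, mul_one, Fin.cons_succ, Fin.val_succ, pow_succ,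
    Finset.mul_sum]
  congr 1
  exact Finset.sum_congr rfl fun i _ => by ring

/-- `λ(2m) = -λ(m)`, `λ(3m) = -λ(m)`, `λ(4m) = λ(m)`. [folklore] -/
theorem liouville_small_mul (m : ℕ) :
    liouville (2 * m) = -liouville m ∧ liouville (3 * m) = -liouville m ∧ liouville (4 * m) = liouville m := by
  have h2 : liouville 2 = -1 := by
    rw [liouville_apply two_ne_zero, cardFactors_apply_prime Nat.prime_two]; norm_num
  have h3 : liouville 3 = -1 := by
    rw [liouville_apply (by norm_num), cardFactors_apply_prime Nat.prime_three]; norm_num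
  have h4 : liouville 4 = 1 := by
    rw [show (4 : ℕ) = 2 * 2 by norm_num, liouville_apply_mul, h2]; norm_num
  refine ⟨?_, ?_, ?_⟩
  · rw [liouville_apply_mul, h2]; ring
  · rw [liouville_apply_mul, h3]; ring
  · rw [liouville_apply_mul, h4]; ring

/-! ### §2 The identities -/

/-- **Nestedness**: `M_{n+1}(r0, c0) = M_n(r, c)`. [folklore] -/
theorem interleaved_nested {n : ℕ} (r c : Fin n → Bool) :
    liouville (1 + 2 * (∑ i : Fin (n + 1), ((Fin.snoc r false : Fin (n + 1) → Bool) i).toNat * 4 ^ (i : ℕ)) +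
        ∑ i : Fin (n + 1), ((Fin.snoc c false : Fin (n + 1) → Bool) i).toNat * 4 ^ (i : ℕ)) =
      liouville (1 + 2 * (∑ i : Fin n, (r i).toNat * 4 ^ (i : ℕ)) + ∑ i : Fin n, (c i).toNat * 4 ^ (i : ℕ)) := by
  rw [sum_snoc_false, sum_snoc_false]

/-- **Times four**: `M_{n+1}(1r, 1c) = M_n(r, c)`, as `1 + 2(1 + 4P(r)) + (1 + 4P(c)) = 4 (1 + 2P(r) + P(c))` and
`λ(4) = 1`. [folklore] -/
theorem interleaved_times_four {n : ℕ} (r c : Fin n → Bool) :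
    liouville (1 + 2 * (∑ i : Fin (n + 1), ((Fin.cons true r : Fin (n + 1) → Bool) i).toNat * 4 ^ (i : ℕ)) +
        ∑ i : Fin (n + 1), ((Fin.cons true c : Fin (n + 1) → Bool) i).toNat * 4 ^ (i : ℕ)) =
      liouville (1 + 2 * (∑ i : Fin n, (r i).toNat * 4 ^ (i : ℕ)) + ∑ i : Fin n, (c i).toNat * 4 ^ (i : ℕ)) := by
  rw [sum_cons, sum_cons, Bool.toNat_true]
  rw [show 1 + 2 * (1 + 4 * ∑ i : Fin n, (r i).toNat * 4 ^ (i : ℕ)) + (1 + 4 * ∑ i : Fin n, (c i).toNat * 4 ^ (i : ℕ))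
      = 4 * (1 + 2 * (∑ i : Fin n, (r i).toNat * 4 ^ (i : ℕ)) + ∑ i : Fin n, (c i).toNat * 4 ^ (i : ℕ)) by ring]
  exact (liouville_small_mul _).2.2

/-- ★ **Times two swaps rows and columns**: `M_{n+1}(c0, 1r) = -M_n(r, c)` — the row index of the left side is the
COLUMN assignment `c` (top digit `0`) and its column index is `1r` (bottom digit `1`, then the ROW assignment `r`):
`1 + 2P(c) + (1 + 4P(r)) = 2 (1 + 2P(r) + P(c))` and `λ(2) = -1`. [folklore] -/
theorem interleaved_times_two_swap {n : ℕ} (r c : Fin n → Bool) :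
    liouville (1 + 2 * (∑ i : Fin (n + 1), ((Fin.snoc c false : Fin (n + 1) → Bool) i).toNat * 4 ^ (i : ℕ)) +
        ∑ i : Fin (n + 1), ((Fin.cons true r : Fin (n + 1) → Bool) i).toNat * 4 ^ (i : ℕ)) =
      -liouville (1 + 2 * (∑ i : Fin n, (r i).toNat * 4 ^ (i : ℕ)) + ∑ i : Fin n, (c i).toNat * 4 ^ (i : ℕ)) := by
  rw [sum_snoc_false, sum_cons, Bool.toNat_true]
  rw [show 1 + 2 * (∑ i : Fin n, (c i).toNat * 4 ^ (i : ℕ)) + (1 + 4 * ∑ i : Fin n, (r i).toNat * 4 ^ (i : ℕ))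
      = 2 * (1 + 2 * (∑ i : Fin n, (r i).toNat * 4 ^ (i : ℕ)) + ∑ i : Fin n, (c i).toNat * 4 ^ (i : ℕ)) by ring]
  exact (liouville_small_mul _).1

/-- **Times three** (carry-free instance): `M_{n+2}((1r)0, 00r) = -λ(1 + 8P(r))` — row assignment `1r` (top digit
`0`), column assignment `00r`: `1 + 2(1 + 4P(r)) + 16P(r) = 3 (1 + 8P(r))` and `λ(3) = -1`; and `λ(1 + 8P(r)) =
M_{n+1}(0r, 0)` is the entry at row `0r`, column `0`. [folklore] -/
theorem interleaved_times_three {n : ℕ} (r : Fin n → Bool) :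
    liouville (1 + 2 * (∑ i : Fin (n + 2),
          ((Fin.snoc (Fin.cons true r : Fin (n + 1) → Bool) false : Fin (n + 2) → Bool) i).toNat * 4 ^ (i : ℕ)) +
        ∑ i : Fin (n + 2), ((Fin.cons false (Fin.cons false r : Fin (n + 1) → Bool) : Fin (n + 2) → Bool) i).toNat *
          4 ^ (i : ℕ)) =
      -liouville (1 + 8 * ∑ i : Fin n, (r i).toNat * 4 ^ (i : ℕ)) := by
  rw [sum_snoc_false, sum_cons, sum_cons, sum_cons, Bool.toNat_true, Bool.toNat_false]
  rw [show 1 + 2 * (1 + 4 * ∑ i : Fin n, (r i).toNat * 4 ^ (i : ℕ)) +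
        (0 + 4 * (0 + 4 * ∑ i : Fin n, (r i).toNat * 4 ^ (i : ℕ)))
      = 3 * (1 + 8 * ∑ i : Fin n, (r i).toNat * 4 ^ (i : ℕ)) by ring]
  exact (liouville_small_mul _).2.1

/-- The companion reading of `λ(1 + 8P(r))` as a prototype entry: `M_{n+1}(0r, 0) = λ(1 + 8P(r))` (row `0r`, zero
column). [folklore] -/
theorem interleaved_row_cons_false_col_zero {n : ℕ} (r : Fin n → Bool) :
    liouville (1 + 2 * (∑ i : Fin (n + 1), ((Fin.cons false r : Fin (n + 1) → Bool) i).toNat * 4 ^ (i : ℕ)) +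
        ∑ i : Fin (n + 1), ((fun _ => false : Fin (n + 1) → Bool) i).toNat * 4 ^ (i : ℕ)) =
      liouville (1 + 8 * ∑ i : Fin n, (r i).toNat * 4 ^ (i : ℕ)) := by
  rw [sum_cons, Bool.toNat_false]
  simp only [Bool.toNat_false, zero_mul, Finset.sum_const_zero, add_zero, zero_add]
  ring_nf

end Summit.ValiantsHypothesis.ValiantsHypothesis.Theorems.LiouvilleSarnakLiouvilleCutRank.InterleavedSymmetries
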